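import Mathlib.Data.Real.Basic
import Mathlib.Tactic

/-!
# Klainerman–Szeftel Lemma 5.1 / §3.6.3 and Giorgi–Klainerman–Szeftel §11.1, §11.7: the interpolated decay rates between the bootstrap levels `k_small` and `k_large`, as real arithmetic

CITATION HEADER (lean-in-tree rule 2026-08-18).  This module is a kernel-checked transcription of the SMALL-CONSTANT
BOOKKEEPING of the published papers

* S. Klainerman, J. Szeftel, *Kerr stability for small angular momentum*, arXiv:2104.11857 (v1, 2021; TeX source
  `Main-Kerr-arxiv.tex`, whose line numbers `KS l.N` are quoted) = bib key `KlainermanSzeftel2021`; journal record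
  Pure Appl. Math. Q. **19** (2023) no. 3, 791–1678 = bib key `KlainermanSzeftel2023` (refereed; its two footnote loci
  below were re-read 2026-08-18 in the authors' accepted manuscript HAL hal-04280491, `HAL PDF p.N` — see STATUS OF THE
  SOURCE; acquisition request acq-07685 of the audit cell concerns the journal offprint);
* E. Giorgi, S. Klainerman, J. Szeftel, *Wave equations estimates and the nonlinear stability of slowly rotating Kerr
  black holes*, arXiv:2205.14808 (v1, 2022; TeX source `FinalKerrarxivversion.tex`, lines `GKS l.N`) = bib key
  `GiorgiKlainermanSzeftel2022`; journal record Pure Appl. Math. Q. **20** (2024) no. 7, 2865–3849 = bib key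
  `GiorgiKlainermanSzeftel2024` (refereed; read as held text `paper:doi-10-4310-pamq-241128023033`, pages `PAMQ p.N`
  = printed page numbers).

WHAT IS TRANSCRIBED (verbatim constants and exponent shapes; every `def` below is a printed formula, nothing else):
1. KS Lemma 5.1 = `\lab{lemma:interpolation}` (KS l.9622–9672; cited by the refereed GKS Remark 11.1.1 as "Lemma 5.1
   in [53]" resp. "(4.6) in [56]"): interpolating a sup bound with `u`-decay exponent `p` at derivative level
   `k_small` (bootstrap assumption BA-D, KS (3.5.2)) against a bound WITHOUT `u`-decay at level `k_large` (BA-B, KS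
   (3.5.1)) yields at level `k` the exponent `p·(1 − (k − k_small)/(k_large − k_small))` — KS l.9634–9640 print
   `(u^{-1/2-δ_dec})^{1-(k_*-k_small)/(k_large-k_small)}` etc.  → `interpExponent`.
2. KS §3.6.3, second frame of `ᵉˣᵗ𝓜` (KS l.6449–6461, display `\lab{eq:constraintsonklossandde0forsecondframeofMext}`):
   "the norms `𝔇'_k` are defined exactly as `𝔇_k` with `δ_dec` replaced by `δ_dec' = δ_dec − 2δ₀`",
   `δ₀ := 130/(k_large − k_small)`, `0 < δ₀ ≤ δ_dec/3`, for `k ≤ k_small + 129`; footnote: "we may thus assume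
   `δ_dec(k_large − k_small) ≥ 390` so that we have indeed `δ₀ ≤ δ_dec/3`".  → `delta0`, `deltaDecPrime`.
   The analogous footnote of Lemma 5.1 (KS l.9644–9647): "assume `δ_dec(k_large − k_small) ≥ 240` so that, in view
   of `k_* = k_small + 80`, `3(k_* − k_small) = 240 ≤ δ_dec(k_large − k_small)`".
3. GKS §11.1 (GKS l.20239–20247): Part II ASSUMES, "for all `k ≤ k_L`, `k_L = k_small + 120`",
   `(r²τ^{1/2+δ_dec} + rτ^{1+δ_dec})|𝔡^{≤k}Γ_g| ≤ ε`, `rτ^{1+δ_dec}|𝔡^{≤k}Γ_b| ≤ ε` ((11.1.1)); and the refereed text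
   adds Remark 11.1.1 (PAMQ p.476; = v1 remark `remark:interpolation-chap11`, GKS l.20266–20269): "in reality the
   estimates (11.1.1)–(11.1.2) for `k_L − 120 ≤ s ≤ k_L` should be relaxed by replacing `δ_dec` with `(3/4)δ_dec`.
   This loss is due to an interpolation … The loss is more than compensated by the fact that the resulting gain
   `(3/4)δ_dec` is doubled in nonlinear estimates, see also Remark 11.2.5", and Remark 11.2.5 (PAMQ p.484): "The
   error terms `ε₀²τ₁^{-2-3δ_dec}` in (11.2.1) and (11.2.2) come from the control of various nonlinear terms … In
   view of assumption (11.1.1), one should in fact expect `ε₀²τ₁^{-2-4δ_dec}`, but the weaker decay of the type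
   `ε₀²τ₁^{-2-3δ_dec}` takes Remark 11.1.1 into account."  → `threeQuarterRate`, `nonlinearErrorRate`.
4. GKS §11.7, proof of Thm M1, Step 7 (GKS l.22524; PAMQ p.532 l.2): "choosing `δ_extra = (3δ_dec − 2δ)/2 > δ_dec`"
   (`δ` = the small `r`-weight parameter, constrained in GKS by "`2δ ≤ δ_dec`", GKS l.24524, and "`δ < δ_dec < δ_B`",
   GKS l.26222); KS Remark after `Ref 2` (KS l.13769–13777): "`δ' > 0` is a small constant satisfying … we may
   choose … `δ' := (δ_extra − δ_dec)/2 > 0`", used throughout KS ch. 6.  → `deltaExtra`, `deltaPrimeKS`.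

WHAT IS CERTIFIED.  Pure real arithmetic on these printed constants (0 sorry; axioms ⊆ {propext, Classical.choice,
Quot.sound}); NOTHING about the Einstein equations, the bootstrap, or the truth of any estimate is asserted:
* §2 `interp_intermediate`, `interp_lemma51` — KS Lemma 5.1's arithmetic (l.9648–9662) checks, GIVEN `δ_dec ≤ 1/2` (the
  printed step "`k_* ≤ k_small + (δ_dec/3)(k_large−k_small)` ⟹ `(2+2δ_dec)(k_*−k_small)/(k_large−k_small) ≤ δ_dec`"
  uses it silently; `interp_intermediate_needs_half` is the witness that it is needed; harmless since KS (3.4.1),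
  l.6079, has `δ_dec ≪ 1`); corollaries `interp_lemma51_at80` (footnote 240, k ≤ k_small+80) and `interp_at120_of_360`
  (the same mechanism reaches `k_small + 120` at the halved rate iff-type threshold 360 — the datum used in the audit
  cell's finding E23).
* §3 `footnote390_iff` (δ₀ ≤ δ_dec/3 ⟺ 390 ≤ δ_dec(k_l−k_s)); `secondFrame_dominated_by_interp` — KS's flat replacement
  `δ_dec ↦ δ_dec − 2δ₀` for `k ≤ k_small + 130` is IMPLIED by KS's own Lemma-5.1 mechanism for every exponent
  `p ≤ 2` (so §3.6.3's unproved "requires an interpolation" is internally consistent); `deltaDecPrime_ge_third`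
  (what 390 guarantees) and `deltaDecPrime_ge_threeQuarter_iff` (δ_dec' ≥ (3/4)δ_dec ⟺ 1040 ≤ δ_dec(k_l−k_s)); for the refereed
  KS's third frame of `ᵉˣᵗ𝓜` (rate `δ_dec − (5/2)δ₀`, HAL PDF p.151) `deltaDecThird_ge_sixth` (what 390 guarantees: `≥ δ_dec/6`) and
  `deltaDecThird_ge_threeQuarter_iff` (⟺ 1300 ≤ δ_dec(k_l−k_s)).
* §4 `interp_at120_ge_threeQuarter_iff` — the EXACT interpolation exponent at `k_small+120` is ≥ `1 + (3/4)δ_dec`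
  ⟺ `480(1+δ_dec) ≤ δ_dec(k_large − k_small)`: GKS Remark 11.1.1's "(3/4)δ_dec" is consistent with the KS hierarchy
  exactly through "`k_large ≫ 1/δ_dec`" (KS (3.4.1) l.6079; GKS l.1699) with implicit constant ≈ 10³ (recall
  `k_small = ⌊k_large/2⌋ + 1`, KS (3.4.6) l.6112).
* §5 `deltaExtra_gt_iff` and its specialisations: with hypothesis rate `δ_h` fed into (11.1.1), Step 7 produces
  `δ_extra(δ_h) = (3δ_h − 2δ)/2`, and KS ch. 6 needs `δ_extra > δ_dec`; this holds ⟺ `δ_h > (2δ_dec + 2δ)/3`.  With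
  KS's supplied `δ_h = δ_dec' = δ_dec − 2δ₀`: ⟺ `δ₀ < δ_dec/6 − δ/3` (`deltaExtra_secondFrame_gt_iff`), which the printed
  constraint `δ₀ ≤ δ_dec/3` does NOT give: `ks390_boundary` shows that at `δ₀ = δ_dec/3` one gets `δ_extra = δ_dec/2 − δ
  < δ_dec`.  With GKS's relaxed `(3/4)δ_dec`: `δ_extra = (9/8)δ_dec − δ > δ_dec ⟺ δ < δ_dec/8` (`deltaExtra_threeQuarter`);
  with the unrelaxed `δ_dec`: `> δ_dec ⟺ δ < δ_dec/2` — STRICT, whereas GKS l.24524 prints "`2δ ≤ δ_dec`"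
  (`deltaExtra_full_gt_iff`); `repair1040` = the audit cell's proposed strengthening (E1(a)): `1040 ≤ δ_dec(k_l − k_s)`
  and `δ < δ_dec/8` ⟹ `δ_extra(δ_dec') > δ_dec`.
* §6 `nonlinearErrorRate_*` — Remark 11.2.5's exponents as arithmetic of "a quadratic error term decays at twice the
  sum of the two hypothesis rates" (the Remark's own explanation): `2·2·δ_dec = 4δ_dec` (expected), `2·2·(3/4)δ_dec =
  3δ_dec` (printed), and `2·2·(δ_dec/3) = (4/3)δ_dec < 2δ_dec` resp. `≥ 2δ_dec ⟺ δ_h ≥ δ_dec/2` (what the KS-supplied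
  rate would give against the output exponent `2 + 2δ_dec` of GKS Thm 12.4.4 / KS Thm M2 — the audit cell's E19/E23
  exponent count; a READING of the remark, flagged as such in the docstrings, not a printed display).

STATUS OF THE SOURCE.  KS and GKS are refereed publications; this module neither re-proves nor disputes any analytic
estimate.  It was written by the audit cell `pub-kerr` (typed skeleton + `|a| ≪ M` census of the Klainerman–Szeftel /
Giorgi–Klainerman–Szeftel proof) to make the cell's constant-level finding "E1(a)" (cell file GAPS.md) checkable by
`lean`: the decay-rate constant which GKS Part II assumes on the top 120 derivatives (`δ_dec`, relaxed in print to
`(3/4)δ_dec` without a displayed computation) is not the one KS §3.6.3 supplies (`δ_dec − 2δ₀ ≥ δ_dec/3` under the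
printed `390`), and the printed `390` does not by itself give KS ch. 6 its `δ' > 0`; both papers only ever assume
`k_large ≫ 1/δ_dec`, under which every threshold below (240, 360, 390, 1040, 1300, 480(1+δ_dec)/δ_dec) is admissible — so the
finding is a MISMATCH OF PRINTED CONSTANTS repairable inside the papers' own hierarchy, and this file records exactly
which inequality repairs it.  The refereed KS did NOT change these constants (audit cell GAPS.md, ADDENDUM E1-J loci):
its §3.6.1 footnote 28 (HAL PDF p.149) prints verbatim "we may thus assume `δ_dec(k_large − k_small) ≥ 390` so that we
have indeed `δ₀ ≤ δ_dec/3`", with (3.6.3) "`δ₀ := 130/(k_large − k_small)`, `0 < δ₀ ≤ δ_dec/3`" (p.149), and its Lemma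
5.1.15 footnote 10 (HAL PDF p.247) prints the `240` footnote verbatim.  What the refereed KS ADDS is a third frame of `ᵉˣᵗ𝓜`
(its Proposition 3.6.5, (3.6.9), HAL PDF p.151): "`δ_dec` replaced by `δ′_dec = δ_dec − (5/2)δ₀` … `max_{0≤k≤k_small+129} ᵉˣᵗ𝔇′_k
≲ ε`", out of which its second global frame is built (Proposition 3.6.11, HAL PDF p.155–156) — the gauge frame of GKS's
Theorem M2 (refereed GKS (12.1.1)–(12.1.3), PAMQ p.544–545, which print the rate `δ_dec` for `k ≤ k_L = k_small + 120`); the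
corresponding threshold for a `(3/4)δ_dec` tolerance there is `1300` (`deltaDecThird_ge_threeQuarter_iff`, §3; whether ch. 12
tolerates `(3/4)δ_dec` as ch. 11's Remark 11.1.1 does is the audit cell's reading, item E21-J, not a printed remark).
Locator caveat: GKS Step 7 prints the intermediate line "`∫_{Σ_*(≥τ)}|∇₃𝔡^{s−1}ψ|² ≲ ε₀²τ^{-(2+3δ_dec−3δ)}`" (GKS
l.22522, PAMQ p.531) between (11.7.12) = `τ^{-(2+3δ_dec−2δ)}` and the choice `δ_extra = (3δ_dec−2δ)/2`; since the flux
norm `F_δ ⊇ F_{Σ_*}` carries `|∇₃ψ|²` unweighted (GKS l.9922), (11.7.12) gives the `−2δ` exponent directly and the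
`−3δ` is a misprint without effect — recorded here, not used.

RELATION TO EXISTING TREE MATERIAL.  `Literature.Geometry.Lorentzian.KlainermanSzeftel2021.Dag` (the cell's proof DAG
over abstract carriers) has the hypothesis edge `EdgeM1hyp` ("GKS (11.1.x) ⇐ KS BA-B/BA-D + §3.6.3") as a NAMED,
undischarged node; this module does not discharge it (the carriers there are opaque) — it certifies the real
arithmetic that any discharge must contain and pins the constant at which it fails / succeeds.
`GiorgiKlainermanSzeftel2022.EstimateShapes` / `CurvatureEstimateShapes` type the SHAPES of (11.7.1)–(11.7.3) with
`δ_extra` as a free parameter; §5 here is the arithmetic of that parameter.  Mathlib only; imports nothing from the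
cell's other modules.  Nothing here is Final-State-Conjecture progress.

## Contents
* §1 definitions `interpExponent`, `delta0`, `deltaDecPrime`, `deltaDecThird`, `threeQuarterRate`, `deltaExtra`, `deltaPrimeKS`,
  `nonlinearErrorRate`;
* §2 KS Lemma 5.1 arithmetic; §3 KS §3.6.3 second frame; §4 GKS Remark 11.1.1 vs exact interpolation;
* §5 `δ_extra` ledger (E1(a)); §6 Remark 11.2.5 exponents.
-/

noncomputable section

namespace Literature.Geometry.Lorentzian.GiorgiKlainermanSzeftel2022.InterpolatedRates

/-! ## §1 The printed constants -/

/-- KS Lemma 5.1 [lemma:interpolation], proof, first display (KS l.9634–9640): interpolating `‖Γ‖_{∞,k_small} ≲ ε w u^{-p}`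
against `‖Γ‖_{∞,k_large} ≲ ε w` gives at level `k` the bound `≲ ε w (u^{-p})^{1-(k-k_small)/(k_large-k_small)}`, i.e. the
`u`-decay exponent `p · (1 − (k − k_small)/(k_large − k_small))`.  Only the exponent is transcribed; levels are reals.
[cite: KlainermanSzeftel2021, Lemma 5.1 (lemma:interpolation) proof, TeX l.9634–9640] -/
def interpExponent (p kSmall kLarge k : ℝ) : ℝ :=
  p * (1 - (k - kSmall) / (kLarge - kSmall))

/-- KS §3.6.3 display (eq:constraintsonklossandde0forsecondframeofMext), KS l.6458–6460:
`δ₀ := 130/(k_large − k_small)`. [cite: KlainermanSzeftel2021, §3.6.3, TeX l.6458–6460] -/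
def delta0 (kSmall kLarge : ℝ) : ℝ := 130 / (kLarge - kSmall)

/-- KS §3.6.3, KS l.6451: "`𝔇'_k` are defined exactly as `𝔇_k` with `δ_dec` replaced by `δ_dec' = δ_dec − 2δ₀`".
[cite: KlainermanSzeftel2021, §3.6.3, TeX l.6451] -/
def deltaDecPrime (δdec kSmall kLarge : ℝ) : ℝ := δdec - 2 * delta0 kSmall kLarge

/-- Refereed KS, Proposition 3.6.5 (3.6.9) (third frame of `ᵉˣᵗ𝓜`, HAL PDF p.151; no v1 counterpart — v1 has one primed frame
of `ᵉˣᵗ𝓜`, KS l.6471, at `δ_dec − 2δ₀`): "`δ_dec` replaced by `δ′_dec = δ_dec − (5/2)δ₀`", `k ≤ k_small + 129`.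
[cite: KlainermanSzeftel2023, Proposition 3.6.5 (3.6.9), HAL PDF p.151] -/
def deltaDecThird (δdec kSmall kLarge : ℝ) : ℝ := δdec - 5 / 2 * delta0 kSmall kLarge

/-- Refereed GKS Remark 11.1.1 (PAMQ p.476; v1 GKS l.20266–20269): on `k_L − 120 ≤ s ≤ k_L` the hypothesis rate
`δ_dec` "should be relaxed by replacing `δ_dec` with `(3/4)δ_dec`".
[cite: GiorgiKlainermanSzeftel2024, Remark 11.1.1, PAMQ p.476; GiorgiKlainermanSzeftel2022, TeX l.20266–20269] -/
def threeQuarterRate (δdec : ℝ) : ℝ := 3 / 4 * δdec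

/-- GKS §11.7 Step 7 (GKS l.22524; PAMQ p.532): "choosing `δ_extra = (3δ_dec − 2δ)/2 > δ_dec`", written as a function
of the hypothesis rate `δh` actually available in (11.1.1) (the printed instance is `δh = δ_dec`).
[cite: GiorgiKlainermanSzeftel2022, §11.7 Step 7, TeX l.22524; GiorgiKlainermanSzeftel2024, PAMQ p.532] -/
def deltaExtra (δh δ : ℝ) : ℝ := (3 * δh - 2 * δ) / 2

/-- KS Remark after Ref 2 of ch. 6 (KS l.13769–13777): "`δ' := (δ_extra − δ_dec)/2 > 0`".
[cite: KlainermanSzeftel2021, ch. 6 Remark after (Ref 2), TeX l.13769–13777] -/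
def deltaPrimeKS (δextra δdec : ℝ) : ℝ := (δextra - δdec) / 2

/-- Refereed GKS Remark 11.2.5 (PAMQ p.484), READ as arithmetic: a quadratic nonlinear error term built from two
quantities each decaying at hypothesis rate `τ^{-1-δh}` (in the flux normalisation of (11.2.1)) contributes
`ε₀² τ₁^{-2-2·(δh+δh)}`; the Remark's two data points are `δh = δ_dec ↦ 4δ_dec` ("one should in fact expect
`τ₁^{-2-4δ_dec}`") and `δh = (3/4)δ_dec ↦ 3δ_dec` ("the weaker decay `τ₁^{-2-3δ_dec}` takes Remark 11.1.1 into account").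
This `def` is the audit cell's reading of that sentence (GAPS.md E19/E23 addendum), not a printed formula.
[cite: GiorgiKlainermanSzeftel2024, Remark 11.2.5, PAMQ p.484 — reading] -/
def nonlinearErrorRate (δh : ℝ) : ℝ := 2 * (δh + δh)

/-- Unfolding lemma for `interpExponent`. [folklore] -/
@[simp] lemma interpExponent_def (p kSmall kLarge k : ℝ) :
    interpExponent p kSmall kLarge k = p * (1 - (k - kSmall) / (kLarge - kSmall)) := rfl
/-- Unfolding lemma for `delta0`. [folklore] -/
@[simp] lemma delta0_def (kSmall kLarge : ℝ) : delta0 kSmall kLarge = 130 / (kLarge - kSmall) := rfl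
/-- Unfolding lemma for `deltaDecPrime` (with `delta0` unfolded). [folklore] -/
@[simp] lemma deltaDecPrime_def (δdec kSmall kLarge : ℝ) :
    deltaDecPrime δdec kSmall kLarge = δdec - 2 * (130 / (kLarge - kSmall)) := rfl
/-- Unfolding lemma for `deltaDecThird` (with `delta0` unfolded). [folklore] -/
@[simp] lemma deltaDecThird_def (δdec kSmall kLarge : ℝ) :
    deltaDecThird δdec kSmall kLarge = δdec - 5 / 2 * (130 / (kLarge - kSmall)) := rfl
/-- Unfolding lemma for `deltaExtra`. [folklore] -/
@[simp] lemma deltaExtra_def (δh δ : ℝ) : deltaExtra δh δ = (3 * δh - 2 * δ) / 2 := rfl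
/-- Unfolding lemma for `deltaPrimeKS`. [folklore] -/
@[simp] lemma deltaPrimeKS_def (δextra δdec : ℝ) : deltaPrimeKS δextra δdec = (δextra - δdec) / 2 := rfl
/-- Unfolding lemma for `threeQuarterRate`. [folklore] -/
@[simp] lemma threeQuarterRate_def (δdec : ℝ) : threeQuarterRate δdec = 3 / 4 * δdec := rfl
/-- `nonlinearErrorRate δh = 4δh`. [folklore] -/
@[simp] lemma nonlinearErrorRate_def (δh : ℝ) : nonlinearErrorRate δh = 4 * δh := by
  unfold nonlinearErrorRate; ring

/-! ## §2 KS Lemma 5.1 (lemma:interpolation): the arithmetic of its proof -/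

/-- KS l.9648–9655: from "`k_* ≤ k_small + (δ_dec/3)(k_large − k_small)`" KS "infer[s]
`(2+2δ_dec)(k_* − k_small)/(k_large − k_small) ≤ δ_dec`".  Checked: it holds given additionally `δ_dec ≤ 1/2`
(used silently; KS (3.4.1) has `δ_dec ≪ 1`); the sign of `δ_dec` is not needed.  Levels are reals with `k_small ≤ k`, `k_small < k_large`.
[cite: KlainermanSzeftel2021, Lemma 5.1 proof, TeX l.9648–9655] -/
theorem interp_intermediate {δ kSmall kLarge k : ℝ} (hgap : kSmall < kLarge) (hk : kSmall ≤ k)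
    (hfoot : 3 * (k - kSmall) ≤ δ * (kLarge - kSmall)) (hδhalf : δ ≤ 1 / 2) :
    (2 + 2 * δ) * ((k - kSmall) / (kLarge - kSmall)) ≤ δ := by
  have hd : 0 < kLarge - kSmall := sub_pos.mpr hgap
  rw [← mul_div_assoc, div_le_iff₀ hd]
  have h1 : (2 + 2 * δ) * (k - kSmall) ≤ 3 * (k - kSmall) := by
    apply mul_le_mul_of_nonneg_right _ (sub_nonneg.mpr hk); linarith
  linarith

/-- Witness that `δ_dec ≤ 1/2` is genuinely used in `interp_intermediate`: with `δ = 1`, `k − k_small = 1`,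
`k_large − k_small = 3` the footnote hypothesis `3(k−k_small) ≤ δ(k_large−k_small)` holds but
`(2+2δ)(k−k_small)/(k_large−k_small) = 4/3 > δ`.  [folklore] -/
theorem interp_intermediate_needs_half :
    ∃ δ kSmall kLarge k : ℝ, kSmall < kLarge ∧ kSmall ≤ k ∧ 3 * (k - kSmall) ≤ δ * (kLarge - kSmall) ∧ 0 ≤ δ ∧
      ¬ (2 + 2 * δ) * ((k - kSmall) / (kLarge - kSmall)) ≤ δ := by
  refine ⟨1, 0, 3, 1, by norm_num, by norm_num, by norm_num, by norm_num, ?_⟩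
  norm_num

/-- KS Lemma 5.1, the two exponent computations KS l.9656–9662, in the form "interpolated exponent ≥ halved-rate
exponent": under the footnote hypothesis `3(k − k_small) ≤ δ_dec(k_large − k_small)` (and `δ_dec ≤ 1/2`),
`(1/2 + δ_dec)(1 − θ) ≥ 1/2 + δ_dec/2` and `(1 + δ_dec)(1 − θ) ≥ 1 + δ_dec/2`, `θ = (k−k_small)/(k_large−k_small)` —
i.e. the printed conclusions `u^{-1/2-δ_dec/2}`, `u^{-1-δ_dec/2}` (KS l.9625–9629, l.9664–9668).
[cite: KlainermanSzeftel2021, Lemma 5.1 (lemma:interpolation), TeX l.9622–9672] -/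
theorem interp_lemma51 {δ kSmall kLarge k : ℝ} (hgap : kSmall < kLarge) (hk : kSmall ≤ k)
    (hfoot : 3 * (k - kSmall) ≤ δ * (kLarge - kSmall)) (hδhalf : δ ≤ 1 / 2) :
    1 / 2 + δ / 2 ≤ interpExponent (1 / 2 + δ) kSmall kLarge k ∧
      1 + δ / 2 ≤ interpExponent (1 + δ) kSmall kLarge k := by
  have hint := interp_intermediate hgap hk hfoot hδhalf
  have hd : 0 < kLarge - kSmall := sub_pos.mpr hgap
  set θ : ℝ := (k - kSmall) / (kLarge - kSmall) with hθ
  have hθ0 : 0 ≤ θ := div_nonneg (sub_nonneg.mpr hk) hd.le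
  simp only [interpExponent_def]
  constructor <;> nlinarith

/-- KS Lemma 5.1 as printed: `k_* = k_small + 80` and footnote "`δ_dec(k_large − k_small) ≥ 240`" (KS l.9644–9647)
give the halved rates for every `k_small ≤ k ≤ k_small + 80`.
[cite: KlainermanSzeftel2021, Lemma 5.1 + footnote, TeX l.9622–9647] -/
theorem interp_lemma51_at80 {δ kSmall kLarge k : ℝ} (hgap : kSmall < kLarge) (hk : kSmall ≤ k)
    (hk80 : k ≤ kSmall + 80) (h240 : 240 ≤ δ * (kLarge - kSmall)) (hδhalf : δ ≤ 1 / 2) :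
    1 / 2 + δ / 2 ≤ interpExponent (1 / 2 + δ) kSmall kLarge k ∧
      1 + δ / 2 ≤ interpExponent (1 + δ) kSmall kLarge k :=
  interp_lemma51 hgap hk (by linarith) hδhalf

/-- The same mechanism reaches GKS's `k_L = k_small + 120` (GKS l.20239) at the HALVED rate under
`δ_dec(k_large − k_small) ≥ 360` (audit datum for the cell's finding E23: KS supplies rate `δ_dec/2`, not `δ_dec`,
on `k_small < k ≤ k_small + 120` along `Σ_*`).  [cite: KlainermanSzeftel2021, Lemma 5.1 mechanism, TeX l.9634–9662;
GiorgiKlainermanSzeftel2022, k_L = k_small+120, TeX l.20239] -/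
theorem interp_at120_of_360 {δ kSmall kLarge k : ℝ} (hgap : kSmall < kLarge) (hk : kSmall ≤ k)
    (hk120 : k ≤ kSmall + 120) (h360 : 360 ≤ δ * (kLarge - kSmall)) (hδhalf : δ ≤ 1 / 2) :
    1 / 2 + δ / 2 ≤ interpExponent (1 / 2 + δ) kSmall kLarge k ∧
      1 + δ / 2 ≤ interpExponent (1 + δ) kSmall kLarge k :=
  interp_lemma51 hgap hk (by linarith) hδhalf

/-- Monotonicity used implicitly by KS ("for `k ≤ k_*`", KS l.9623, l.9633): for `p ≥ 0` the interpolated exponent is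
antitone in the level `k`.  [folklore] -/
theorem interpExponent_antitone {p kSmall kLarge k k' : ℝ} (hgap : kSmall < kLarge) (hp : 0 ≤ p) (hkk' : k ≤ k') :
    interpExponent p kSmall kLarge k' ≤ interpExponent p kSmall kLarge k := by
  have hd : 0 < kLarge - kSmall := sub_pos.mpr hgap
  simp only [interpExponent_def]
  apply mul_le_mul_of_nonneg_left _ hp
  have : (k - kSmall) / (kLarge - kSmall) ≤ (k' - kSmall) / (kLarge - kSmall) :=
    div_le_div_of_nonneg_right (by linarith) hd.le
  linarith

/-! ## §3 KS §3.6.3: the second frame of `ᵉˣᵗ𝓜` (`δ₀`, `δ_dec'`, footnote 390) -/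

/-- KS footnote at l.6452–6457: "`δ_dec(k_large−k_small) ≥ 390` so that we have indeed `δ₀ ≤ δ_dec/3`" — as an
equivalence.  [cite: KlainermanSzeftel2021, §3.6.3 footnote, TeX l.6452–6460] -/
theorem footnote390_iff {δdec kSmall kLarge : ℝ} (hgap : kSmall < kLarge) :
    delta0 kSmall kLarge ≤ δdec / 3 ↔ 390 ≤ δdec * (kLarge - kSmall) := by
  have hd : 0 < kLarge - kSmall := sub_pos.mpr hgap
  rw [delta0_def, div_le_iff₀ hd]
  constructor <;> intro h <;> nlinarith

/-- What the printed 390 guarantees: `δ_dec' = δ_dec − 2δ₀ ≥ δ_dec/3` (and no more at the boundary, see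
`ks390_boundary`).  [cite: KlainermanSzeftel2021, §3.6.3, TeX l.6449–6461] -/
theorem deltaDecPrime_ge_third {δdec kSmall kLarge : ℝ} (hgap : kSmall < kLarge)
    (h390 : 390 ≤ δdec * (kLarge - kSmall)) :
    δdec / 3 ≤ deltaDecPrime δdec kSmall kLarge := by
  have h := (footnote390_iff (δdec := δdec) hgap).mpr h390
  rw [delta0_def] at h
  rw [deltaDecPrime_def]
  linarith

/-- KS §3.6.3 gives no proof of the flat loss `2δ₀` ("This requires an interpolation between the decay norms, for
`k ≤ k_small` and the boundedness norms for `k ≤ k_large`", KS l.6449–6450).  Certified: KS's own Lemma-5.1 mechanism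
implies it — for every exponent `p ≤ 2` (the exponents at stake are `1/2 + δ_dec` and `1 + δ_dec`) and every level
`k_small ≤ k ≤ k_small + 130` (KS: `k ≤ k_small + 129`), `p·(1 − θ) ≥ p − 2δ₀`.
[cite: KlainermanSzeftel2021, §3.6.3 TeX l.6449–6461 with Lemma 5.1 mechanism TeX l.9634–9640] -/
theorem secondFrame_dominated_by_interp {p kSmall kLarge k : ℝ} (hgap : kSmall < kLarge) (hk : kSmall ≤ k)
    (hk130 : k ≤ kSmall + 130) (hp2 : p ≤ 2) :
    p - 2 * delta0 kSmall kLarge ≤ interpExponent p kSmall kLarge k := by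
  have hd : 0 < kLarge - kSmall := sub_pos.mpr hgap
  simp only [interpExponent_def, delta0_def]
  have hθ : (k - kSmall) / (kLarge - kSmall) ≤ 130 / (kLarge - kSmall) :=
    div_le_div_of_nonneg_right (by linarith) hd.le
  have hθ0 : 0 ≤ (k - kSmall) / (kLarge - kSmall) := div_nonneg (sub_nonneg.mpr hk) hd.le
  have h130 : 0 ≤ 130 / (kLarge - kSmall) := by positivity
  nlinarith

/-- The audit cell's threshold (GAPS.md E1(a) repair): `δ_dec' ≥ (3/4)δ_dec` (the rate the refereed GKS Remark 11.1.1
asks for) ⟺ `1040 ≤ δ_dec(k_large − k_small)`, versus KS's printed `390`.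
[cite: KlainermanSzeftel2021, §3.6.3, TeX l.6449–6461; GiorgiKlainermanSzeftel2024, Remark 11.1.1, PAMQ p.476] -/
theorem deltaDecPrime_ge_threeQuarter_iff {δdec kSmall kLarge : ℝ} (hgap : kSmall < kLarge) :
    threeQuarterRate δdec ≤ deltaDecPrime δdec kSmall kLarge ↔ 1040 ≤ δdec * (kLarge - kSmall) := by
  have hd : 0 < kLarge - kSmall := sub_pos.mpr hgap
  rw [threeQuarterRate_def, deltaDecPrime_def]
  constructor
  · intro h
    have h' : 2 * (130 / (kLarge - kSmall)) ≤ δdec / 4 := by linarith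
    rw [← le_div_iff₀' (by norm_num : (0:ℝ) < 2)] at h'
    rw [div_le_iff₀ hd] at h'
    linarith
  · intro h
    have h' : 130 / (kLarge - kSmall) ≤ δdec / 8 := by
      rw [div_le_iff₀ hd]; linarith
    linarith

/-- Refereed third frame: what the printed `390` (`δ₀ ≤ δ_dec/3`) guarantees for `δ_dec − (5/2)δ₀` is `≥ δ_dec/6` — still
positive, but further from GKS (12.1.1)'s printed `δ_dec`.  [cite: KlainermanSzeftel2023, Proposition 3.6.5 (3.6.9), HAL PDF p.151;
§3.6.1 footnote 28 and (3.6.3), HAL PDF p.149] -/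
theorem deltaDecThird_ge_sixth {δdec kSmall kLarge : ℝ} (hgap : kSmall < kLarge)
    (h390 : 390 ≤ δdec * (kLarge - kSmall)) :
    δdec / 6 ≤ deltaDecThird δdec kSmall kLarge := by
  have h := (footnote390_iff (δdec := δdec) hgap).mpr h390
  rw [deltaDecThird_def]; rw [delta0_def] at h; linarith

/-- The audit cell's threshold for the refereed third frame / second global frame (GAPS.md E21-J; the `(3/4)δ_dec` tolerance
of GKS ch. 12 is the cell's reading by analogy with Remark 11.1.1, not printed): `δ_dec − (5/2)δ₀ ≥ (3/4)δ_dec ⟺ δ₀ ≤ δ_dec/10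
⟺ 1300 ≤ δ_dec(k_large − k_small)`, versus `1040` for `δ_dec − 2δ₀` and KS's printed `390`.
[cite: KlainermanSzeftel2023, Proposition 3.6.5 (3.6.9), HAL PDF p.151, Proposition 3.6.11, p.155–156; GiorgiKlainermanSzeftel2024, (12.1.1), PAMQ p.544–545, Remark 11.1.1, p.476] -/
theorem deltaDecThird_ge_threeQuarter_iff {δdec kSmall kLarge : ℝ} (hgap : kSmall < kLarge) :
    threeQuarterRate δdec ≤ deltaDecThird δdec kSmall kLarge ↔ 1300 ≤ δdec * (kLarge - kSmall) := by
  have hd : 0 < kLarge - kSmall := sub_pos.mpr hgap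
  rw [threeQuarterRate_def, deltaDecThird_def]
  constructor
  · intro h
    have h' : 130 / (kLarge - kSmall) ≤ δdec / 10 := by linarith
    rw [div_le_iff₀ hd] at h'
    linarith
  · intro h
    have h' : 130 / (kLarge - kSmall) ≤ δdec / 10 := by
      rw [div_le_iff₀ hd]; linarith
    linarith

/-- The three thresholds are ordered: `1300 ⟹ 1040 ⟹ 390` at fixed `δ_dec(k_large − k_small)`.  [folklore] -/
theorem thresholds_ordered {D : ℝ} : (1300 ≤ D → 1040 ≤ D) ∧ (1040 ≤ D → 390 ≤ D) :=
  ⟨fun h => by linarith, fun h => by linarith⟩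

/-! ## §4 GKS Remark 11.1.1 ("(3/4)δ_dec") against the exact interpolation exponent at `k_L = k_small + 120` -/

/-- The EXACT Lemma-5.1 exponent at level `k_small + 120` for the `Γ_b`, `∇Γ_g` rate `1 + δ_dec` is at least
`1 + (3/4)δ_dec` (GKS Remark 11.1.1) ⟺ `480(1 + δ_dec) ≤ δ_dec(k_large − k_small)`.  Both papers assume only
`k_large ≫ 1/δ_dec` (KS (3.4.1) l.6079, GKS l.1699), `k_small = ⌊k_large/2⌋ + 1` (KS (3.4.6) l.6112–6114).
[cite: GiorgiKlainermanSzeftel2024, Remark 11.1.1, PAMQ p.476; KlainermanSzeftel2021, Lemma 5.1, TeX l.9634–9640] -/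
theorem interp_at120_ge_threeQuarter_iff {δ kSmall kLarge : ℝ} (hgap : kSmall < kLarge) :
    1 + threeQuarterRate δ ≤ interpExponent (1 + δ) kSmall kLarge (kSmall + 120) ↔
      480 * (1 + δ) ≤ δ * (kLarge - kSmall) := by
  have hd : 0 < kLarge - kSmall := sub_pos.mpr hgap
  simp only [interpExponent_def, threeQuarterRate_def, add_sub_cancel_left]
  rw [show (1 + δ) * (1 - 120 / (kLarge - kSmall)) = (1 + δ) - (1 + δ) * 120 / (kLarge - kSmall) by ring]
  constructor
  · intro h
    have h' : (1 + δ) * 120 / (kLarge - kSmall) ≤ δ / 4 := by linarith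
    rw [div_le_iff₀ hd] at h'
    linarith
  · intro h
    have h' : (1 + δ) * 120 / (kLarge - kSmall) ≤ δ / 4 := by
      rw [div_le_iff₀ hd]; linarith
    linarith

/-- The same for the `Γ_g` sup rate `1/2 + δ_dec`: exact exponent at `k_small + 120` ≥ `1/2 + (3/4)δ_dec`
⟺ `480(1/2 + δ_dec) ≤ δ_dec(k_large − k_small)` (weaker than the previous threshold).
[cite: GiorgiKlainermanSzeftel2024, Remark 11.1.1, PAMQ p.476; KlainermanSzeftel2021, Lemma 5.1, TeX l.9634–9640] -/
theorem interp_at120_ge_threeQuarter_iff_half {δ kSmall kLarge : ℝ} (hgap : kSmall < kLarge) :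
    1 / 2 + threeQuarterRate δ ≤ interpExponent (1 / 2 + δ) kSmall kLarge (kSmall + 120) ↔
      480 * (1 / 2 + δ) ≤ δ * (kLarge - kSmall) := by
  have hd : 0 < kLarge - kSmall := sub_pos.mpr hgap
  simp only [interpExponent_def, threeQuarterRate_def, add_sub_cancel_left]
  rw [show (1 / 2 + δ) * (1 - 120 / (kLarge - kSmall)) = (1 / 2 + δ) - (1 / 2 + δ) * 120 / (kLarge - kSmall) by ring]
  constructor
  · intro h
    have h' : (1 / 2 + δ) * 120 / (kLarge - kSmall) ≤ δ / 4 := by linarith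
    rw [div_le_iff₀ hd] at h'
    linarith
  · intro h
    have h' : (1 / 2 + δ) * 120 / (kLarge - kSmall) ≤ δ / 4 := by
      rw [div_le_iff₀ hd]; linarith
    linarith

/-- Comparison of the two routes to Remark 11.1.1's rate on the top 120 derivatives, for `0 < δ_dec ≤ 1`: KS's flat
loss (`1040 ≤ δ_dec(k_l−k_s)`, `deltaDecPrime_ge_threeQuarter_iff`) is the MORE demanding one — it implies the exact
interpolation threshold `480(1+δ_dec)`.  [folklore] -/
theorem threshold1040_implies_480 {δ D : ℝ} (hδ1 : δ ≤ 1) (h : 1040 ≤ δ * D) : 480 * (1 + δ) ≤ δ * D := by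
  nlinarith

/-! ## §5 The `δ_extra` ledger (audit finding E1(a)) -/

/-- Core equivalence: Step 7 run with hypothesis rate `δh` yields `δ_extra(δh) = (3δh − 2δ)/2`, and KS ch. 6 needs
`δ_extra > δ_dec` (KS l.13769–13777: `δ' = (δ_extra − δ_dec)/2 > 0`); this holds ⟺ `δh > (2δ_dec + 2δ)/3`.
[cite: GiorgiKlainermanSzeftel2022, §11.7 Step 7, TeX l.22524; KlainermanSzeftel2021, TeX l.13769–13777] -/
theorem deltaExtra_gt_iff (δh δ δdec : ℝ) : δdec < deltaExtra δh δ ↔ (2 * δdec + 2 * δ) / 3 < δh := by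
  rw [deltaExtra_def]; constructor <;> intro h <;> linarith

/-- `δ' > 0` in KS's sense is literally `δ_extra > δ_dec`.  [cite: KlainermanSzeftel2021, TeX l.13769–13777] -/
theorem deltaPrimeKS_pos_iff (δextra δdec : ℝ) : 0 < deltaPrimeKS δextra δdec ↔ δdec < δextra := by
  rw [deltaPrimeKS_def]; constructor <;> intro h <;> linarith

/-- GKS as printed (`δh = δ_dec`): "`δ_extra = (3δ_dec − 2δ)/2 > δ_dec`" ⟺ `δ < δ_dec/2` — STRICT; GKS l.24524 prints the
constraint as "`2δ ≤ δ_dec`" (and l.26222 "`δ < δ_dec`"), under which only `≥` follows.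
[cite: GiorgiKlainermanSzeftel2022, TeX l.22524, l.24524, l.26222] -/
theorem deltaExtra_full_gt_iff (δ δdec : ℝ) : δdec < deltaExtra δdec δ ↔ δ < δdec / 2 := by
  rw [deltaExtra_def]; constructor <;> intro h <;> linarith

/-- … and the non-strict version that "`2δ ≤ δ_dec`" does give.  [cite: GiorgiKlainermanSzeftel2022, TeX l.22524, l.24524] -/
theorem deltaExtra_full_ge_of (δ δdec : ℝ) (h : 2 * δ ≤ δdec) : δdec ≤ deltaExtra δdec δ := by
  rw [deltaExtra_def]; linarith

/-- With GKS Remark 11.1.1's relaxed rate `(3/4)δ_dec`: `δ_extra = (9/8)δ_dec − δ`, `> δ_dec ⟺ δ < δ_dec/8`.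
[cite: GiorgiKlainermanSzeftel2024, Remark 11.1.1, PAMQ p.476, with §11.7 Step 7, PAMQ p.532] -/
theorem deltaExtra_threeQuarter (δ δdec : ℝ) :
    deltaExtra (threeQuarterRate δdec) δ = 9 / 8 * δdec - δ ∧
      (δdec < deltaExtra (threeQuarterRate δdec) δ ↔ δ < δdec / 8) := by
  refine ⟨by rw [deltaExtra_def, threeQuarterRate_def]; ring, ?_⟩
  rw [deltaExtra_def, threeQuarterRate_def]; constructor <;> intro h <;> linarith

/-- With the rate KS §3.6.3 actually supplies on `k_small < k ≤ k_small + 129`, `δh = δ_dec' = δ_dec − 2δ₀`: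
`δ_extra(δ_dec') > δ_dec ⟺ δ₀ < δ_dec/6 − δ/3` (cell finding E1(a)).
[cite: KlainermanSzeftel2021, §3.6.3, TeX l.6449–6461; GiorgiKlainermanSzeftel2022, TeX l.22524] -/
theorem deltaExtra_secondFrame_gt_iff (δ δdec kSmall kLarge : ℝ) :
    δdec < deltaExtra (deltaDecPrime δdec kSmall kLarge) δ ↔ delta0 kSmall kLarge < δdec / 6 - δ / 3 := by
  rw [deltaExtra_def, deltaDecPrime_def, delta0_def]; constructor <;> intro h <;> linarith

/-- The printed constraint is not enough: at its boundary `δ₀ = δ_dec/3` (i.e. `δ_dec(k_large − k_small) = 390`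
exactly) one gets `δ_dec' = δ_dec/3` and `δ_extra(δ_dec') = δ_dec/2 − δ`, which is `< δ_dec` for every `δ ≥ 0 < δ_dec`
— KS ch. 6's `δ' > 0` then FAILS.  [cite: KlainermanSzeftel2021, §3.6.3 footnote (390), TeX l.6452–6460, and
TeX l.13769–13777; GiorgiKlainermanSzeftel2022, TeX l.22524] -/
theorem ks390_boundary {δ δdec kSmall kLarge : ℝ} (hb : delta0 kSmall kLarge = δdec / 3) :
    deltaDecPrime δdec kSmall kLarge = δdec / 3 ∧
      deltaExtra (deltaDecPrime δdec kSmall kLarge) δ = δdec / 2 - δ ∧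
      (0 ≤ δ → 0 < δdec → deltaExtra (deltaDecPrime δdec kSmall kLarge) δ < δdec) := by
  rw [delta0_def] at hb
  refine ⟨?_, ?_, ?_⟩
  · rw [deltaDecPrime_def, hb]; ring
  · rw [deltaExtra_def, deltaDecPrime_def, hb]; ring
  · intro hδ hdec; rw [deltaExtra_def, deltaDecPrime_def, hb]; linarith

/-- A concrete instance of the boundary: `δ_dec = 1/10`, `k_large − k_small = 3900` (so `δ_dec(k_l−k_s) = 390`, KS's
footnote satisfied with equality), `δ = 1/100`: `δ_extra(δ_dec') = 1/20 − 1/100 < 1/10 = δ_dec`.  [folklore] -/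
theorem ks390_boundary_instance :
    deltaExtra (deltaDecPrime (1 / 10) 0 3900) (1 / 100) < 1 / 10 ∧ (390 : ℝ) ≤ 1 / 10 * (3900 - 0) := by
  simp only [deltaExtra_def, deltaDecPrime_def]; norm_num

/-- The audit cell's repair (GAPS.md E1(a)): strengthen KS's footnote to `1040 ≤ δ_dec(k_large − k_small)` (⟹ `δ₀ ≤
δ_dec/8`, `δ_dec' ≥ (3/4)δ_dec`) and take `δ < δ_dec/8`; then `δ_extra(δ_dec') ≥ (9/8)δ_dec − δ > δ_dec`.  Admissible
inside both papers' hierarchy `k_large ≫ 1/δ_dec`, `δ ≪ δ_dec`; printed by neither.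
[cite: KlainermanSzeftel2021, §3.6.3, TeX l.6449–6461, (3.4.1) l.6079; GiorgiKlainermanSzeftel2022, TeX l.22524, l.24524] -/
theorem repair1040 {δ δdec kSmall kLarge : ℝ} (hgap : kSmall < kLarge) (h1040 : 1040 ≤ δdec * (kLarge - kSmall))
    (hδ : δ < δdec / 8) :
    9 / 8 * δdec - δ ≤ deltaExtra (deltaDecPrime δdec kSmall kLarge) δ ∧
      δdec < deltaExtra (deltaDecPrime δdec kSmall kLarge) δ := by
  have h34 := (deltaDecPrime_ge_threeQuarter_iff (δdec := δdec) hgap).mpr h1040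
  rw [threeQuarterRate_def] at h34
  constructor
  · rw [deltaExtra_def]; linarith
  · rw [deltaExtra_def]; linarith

/-- `δ_extra` is monotone in the hypothesis rate, so any `δh ≥ (3/4)δ_dec` with `δ < δ_dec/8` works.  [folklore] -/
theorem deltaExtra_mono {δh δh' δ : ℝ} (h : δh ≤ δh') : deltaExtra δh δ ≤ deltaExtra δh' δ := by
  simp only [deltaExtra_def]; linarith

/-! ## §6 Remark 11.2.5's exponents (a reading; see the docstring of `nonlinearErrorRate`) -/

/-- The Remark's two printed data points check: rate `δ_dec ↦ 4δ_dec` ("expect `τ₁^{-2-4δ_dec}`"), rate `(3/4)δ_dec ↦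
3δ_dec` ("`τ₁^{-2-3δ_dec}` takes Remark 11.1.1 into account").
[cite: GiorgiKlainermanSzeftel2024, Remark 11.2.5, PAMQ p.484 — reading] -/
theorem nonlinearErrorRate_printed (δdec : ℝ) :
    nonlinearErrorRate δdec = 4 * δdec ∧ nonlinearErrorRate (threeQuarterRate δdec) = 3 * δdec := by
  refine ⟨nonlinearErrorRate_def δdec, ?_⟩
  rw [nonlinearErrorRate_def, threeQuarterRate_def]; ring

/-- Against the OUTPUT exponent `2 + 2δ_dec` of the flux decay (GKS Thm 12.4.4 (12.4.5), TeX l.24284–24287; KS Thm M2,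
TeX l.6695): the quadratic error rate is at least the output rate ⟺ `δh ≥ δ_dec/2`; the relaxed `(3/4)δ_dec` leaves
slack `δ_dec`; the KS-guaranteed `δ_dec/3` gives `(4/3)δ_dec < 2δ_dec` for `δ_dec > 0` (cell findings E19/E23, exponent
count only).  [cite: GiorgiKlainermanSzeftel2024, Remark 11.2.5, PAMQ p.484 — reading; GiorgiKlainermanSzeftel2022,
TeX l.24284–24287] -/
theorem nonlinearErrorRate_vs_output (δdec δh : ℝ) :
    (2 * δdec ≤ nonlinearErrorRate δh ↔ δdec / 2 ≤ δh) ∧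
      nonlinearErrorRate (threeQuarterRate δdec) - 2 * δdec = δdec ∧
      (0 < δdec → nonlinearErrorRate (δdec / 3) < 2 * δdec) := by
  simp only [nonlinearErrorRate_def, threeQuarterRate_def]
  refine ⟨⟨fun h => by linarith, fun h => by linarith⟩, by ring, fun h => by linarith⟩

end Literature.Geometry.Lorentzian.GiorgiKlainermanSzeftel2022.InterpolatedRates

end
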